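import Summits.CriticalPhenomena.PercolationContinuityZ3.Theorems.SubcritExchangeUniformity.Negative.VerticalRusso

/-!
# `SubcritExchangeUniformity` (K⁻, crux stmt-CriticalPhenomena-16062, route `PercExchangeRateTransport`),
# negative lane, part 2: the `δ(η)`-cutoff is load-bearing AS TYPED

Guard lemmas from the crux disprover (cdisprove, cycle 1). Nothing in this file asserts the crux
(or any Theses decl) positively; no definitions.

The crux K⁻ reads, for the label-coupled anisotropic family on `ℤ²×ℤ` (x/y-bonds open iff
`U_e ≤ p`, z-bonds iff `U_e ≤ t`, `Θ_n(p,t) = P(0 ↔ ∂Λ_n in Λ_n)`, `p_c(t)` the critical curve):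
for every compact sub-arc `[lo,hi] ⊂ (0,1)` there is a continuous `σ` with
`|∂_tΘ_n(p,t) − σ(t) ∂_pΘ_n(p,t)| ≤ η ∂_pΘ_n(p,t)` for `n ≥ m(η)`, `t ∈ [lo,hi]` and
`p_c(t) − δ(η) ≤ p ≤ p_c(t)` (all `deriv`s are Mathlib's `deriv`).

From `Objects` (§2: `∂_pΘ_n = 0` on the closed half-plane `{p ≤ 0}`) and `VerticalRusso`
(`∂_tΘ_n > 0` for `n ≥ 1`, `p < 1`, `t ∈ (0,1)`):

* `delta_lt_pcurve` — THE GUARD: if the exchange-rate inequality of K⁻ holds at a level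
  `t ∈ (0,1)` for all `n ≥ m` on the strip `[p_c(t) − δ, p_c(t)]` (any slope `σ`, any tolerance
  `η`), then `δ < p_c(t)`. (Otherwise `p = 0` lies in the strip, where `∂_pΘ_n = 0 < ∂_tΘ_n` makes
  the inequality read `∂_tΘ_n(0,t) ≤ 0`.) So ANY proof of K⁻ must choose
  `δ(η) < inf_{[lo,hi]} p_c`, i.e. must invoke a positive lower bound on the anisotropic critical
  curve on compact sub-arcs (consequently K⁻ implies `0 < p_c(t)` on `(0,1)` — the positivity
  conjunct of the route item `CriticalCurveRegular`; that corollary, which names the crux, is filed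
  separately).
* `subcritExchangeUniformity_false_without_cutoff` — the natural un-localised strengthening
  (K⁻ with the `δ(η)`-strip replaced by the whole closed physical segment `0 ≤ p ≤ p_c(t)`,
  `∃ δ` dropped; stated inline with the crux's verbatim `let`-preamble) is FALSE: the localisation
  is load-bearing as typed, already for the degenerate boundary reason above — independently of the
  face-selection mechanism of the route rationale, which is the PHYSICAL (unformalised) reason no
  fixed collar works deep in the subcritical strip. The same boundary effect bites the line stub
  `stub_upperSubcurveBound` (at `p = 0` it reads `∂_tΘ_n(0,t) ∂_pΘ_n(p_c t,t) ≤ 0`) but not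
  `stub_lowerSubcurveBound` (there it reads `0 ≤ ∂_tΘ_n(0,t) ∂_pΘ_n(p_c t,t)`).
-/

noncomputable section

namespace Summit.CriticalPhenomena.PercolationContinuityZ3.Theorems.SubcritExchangeUniformity.Negative

open MeasureTheory Filter Topology
open Literature.Probability.Percolation Literature.Probability.LatticeModels
open Literature.Probability.Percolation.DCT16

/-! ## §4 The guard: any admissible `δ` is `< p_c(t)`; hence K⁻ ⟹ `0 < p_c(t)` -/

/-- **THE GUARD.** If, at a level `t ∈ (0,1)`, the exchange-rate inequality of K⁻ holds for all
`n ≥ m` on the strip `[p_c(t) − δ, p_c(t)]` (for some slope `σ` and tolerance `η`), then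
`δ < p_c(t)`: otherwise `p = 0` lies in the strip and there `∂_pΘ_n = 0 < ∂_tΘ_n` turns the
inequality into `∂_tΘ_n(0,t) ≤ 0`. So every proof of K⁻ must take `δ(η) < inf_{[lo,hi]} p_c`.
[folklore] -/
theorem delta_lt_pcurve {σ η δ : ℝ} {m : ℕ} {t : ℝ} (ht : t ∈ Set.Ioo (0 : ℝ) 1)
    (h : ∀ n ≥ m, ∀ p : ℝ, pcurve t - δ ≤ p → p ≤ pcurve t →
      |deriv (fun s => ThetaBox n p s) t - σ * deriv (fun q => ThetaBox n q t) p| ≤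
        η * deriv (fun q => ThetaBox n q t) p) :
    δ < pcurve t := by
  by_contra hδ
  rw [not_lt] at hδ
  have key := h (max m 1) (le_max_left _ _) 0 (by linarith) (pcurve_nonneg t)
  rw [deriv_p_eq_zero_of_nonpos (max m 1) t le_rfl, mul_zero, mul_zero, sub_zero] at key
  have hpos := deriv_t_pos (max m 1) (le_max_right _ _) zero_lt_one ht (p := 0)
  exact absurd (abs_nonpos_iff.1 key) hpos.ne'

/-! ## §5 The un-localised strengthening is false -/

/-- **The `δ(η)`-localisation of K⁻ is load-bearing as typed.** The negated statement below is
`SubcritExchangeUniformity` WITHOUT the `δ(η)`-cutoff: the crux with the strip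
`p_c(t) − δ ≤ p ≤ p_c(t)` replaced by the whole closed physical segment `0 ≤ p ≤ p_c(t)` (the
quantifier `∃ δ > 0` dropped), verbatim otherwise (same `let`-preamble as the crux). It is FALSE
(witness: `[lo,hi] = [1/4,1/2]`, `η = 1`, `t = 1/4`, `p = 0`, `n = max m 1`; via `delta_lt_pcurve`
with `δ = p_c(1/4)`). The physical reason no FIXED collar can work (face selection deep in the
subcritical strip, route rationale) is a different, unformalised mechanism; this lemma certifies
only the typed boundary effect at `p = 0`. [folklore] -/
theorem subcritExchangeUniformity_false_without_cutoff :
    ¬ (let μ := Literature.Probability.Percolation.labelMeasure (Literature.Probability.LatticeModels.Site 3)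
       let vert : Sym2 (Literature.Probability.LatticeModels.Site 3) → Prop :=
         fun e => ∃ x : Literature.Probability.LatticeModels.Site 3, e = s(x, x + Pi.single (2 : Fin 3) 1)
       let cfg : ℝ → ℝ → (Sym2 (Literature.Probability.LatticeModels.Site 3) → ℝ) →
           Set (Sym2 (Literature.Probability.LatticeModels.Site 3)) :=
         fun p t U => {e | e ∈ (Literature.Probability.LatticeModels.zdGraph 3).edgeSet ∧
           ((vert e ∧ U e ≤ t) ∨ (¬ vert e ∧ U e ≤ p))}
       let Θ : ℕ → ℝ → ℝ → ℝ :=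
         fun n p t => μ.real {U | cfg p t U ∈ Literature.Probability.Percolation.siteToBoundary 3 n}
       let θ : ℝ → ℝ → ℝ :=
         fun p t => μ.real {U | cfg p t U ∈ Literature.Probability.Percolation.percolatesAt
           (0 : Literature.Probability.LatticeModels.Site 3)}
       let pc : ℝ → ℝ := fun t => sInf ({p : ℝ | 0 ≤ p ∧ p ≤ 1 ∧ 0 < θ p t} ∪ {1})
       ∀ lo hi : ℝ, 0 < lo → lo < hi → hi < 1 → ∃ σ : ℝ → ℝ, ContinuousOn σ (Set.Icc lo hi) ∧
         ∀ η > (0 : ℝ), ∃ m : ℕ, ∀ n ≥ m, ∀ t ∈ Set.Icc lo hi, ∀ p : ℝ, 0 ≤ p → p ≤ pc t →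
           |deriv (fun s => Θ n p s) t - σ t * deriv (fun q => Θ n q t) p| ≤
             η * deriv (fun q => Θ n q t) p) := by
  intro h
  obtain ⟨σ, -, hη⟩ := h (1 / 4) (1 / 2) (by norm_num) (by norm_num) (by norm_num)
  obtain ⟨m, hm⟩ := hη 1 one_pos
  have ht : (1 / 4 : ℝ) ∈ Set.Ioo (0 : ℝ) 1 := ⟨by norm_num, by norm_num⟩
  have hmem : (1 / 4 : ℝ) ∈ Set.Icc (1 / 4 : ℝ) (1 / 2) := ⟨le_rfl, by norm_num⟩
  have hlt : pcurve (1 / 4) < pcurve (1 / 4) :=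
    delta_lt_pcurve (σ := σ (1 / 4)) (η := 1) (δ := pcurve (1 / 4)) (m := m) ht
      fun n hn p hp1 hp2 => hm n hn (1 / 4) hmem p (by linarith) hp2
  exact lt_irrefl _ hlt

end Summit.CriticalPhenomena.PercolationContinuityZ3.Theorems.SubcritExchangeUniformity.Negative

end
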